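import Literature.Analysis.FluidPDE.MikadoPipeProfiles
import Literature.Analysis.FluidPDE.MikadoShearPotential
import Literature.Analysis.FunctionSpaces.TorusPlateauCutoff
import Literature.Analysis.FunctionSpaces.TorusLiftDerivBounds
import Mathlib.LinearAlgebra.CrossProduct
import HarnessLib

/-!
# Six pairwise disjoint periodic pipes for the Nash directions (Coiculescu–Palasek §3.1, Lemma 3.2)

Analysis/FluidPDE support file (definitions with proved API; no named facts) on the discharge path of
the principal-parts hypothesis `hA` of
`Literature.Barriers.NavierStokesRegularity.CriticalDataSmoothNonuniqueness_of_principalParts_of_perturbationLe`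
(M. P. Coiculescu, S. Palasek, Invent. Math. 244 (2025), arXiv:2503.14699). §3.1 fixes six directions
`θ_j ∈ ℤ³` (`CP25.nashDir`), points `x_j ∈ 𝕋³` and a pipe width `δ₀` such that the `δ₀`-pipes
`{dist(x, x_j + ℝθ_j) < δ₀}` are pairwise disjoint (assumption (pipesseparated), used in Prop. 4.1:
"`𝒩_{k,3}` consists of cross terms which vanish identically due to the pipe separation assumption"),
and profiles `φ̃_j` equal to `1` on the axis and supported in the pipe. This file makes these choices
EXPLICIT and proves the separation arithmetically:

* `CP25.shiftDir = (1, 10, 100)`, `CP25.shiftStep = 10⁻⁴`, `CP25.pipeShiftE j = (j+1)·10⁻⁴·(1,10,100)`,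
  `CP25.pipeCenter j = proj (pipeShiftE j)` — explicit CHOICES realising the existence statement of §3.1 (the paper
  fixes no numbers); the separating integer vectors are Mathlib's `crossProduct (nashDir i) (nashDir j)`;
* `CP25.pipeRadius = 10⁻⁶` and `CP25.pipeBump : 𝕋² → [0,1]` — a smooth planar profile `= 1` on the ball
  of radius `10⁻⁶` around `0` and `= 0` off the ball of radius `5·10⁻⁶` (from `Torus.exists_plateau_cutoff`);
* `CP25.pipeFn j = pipeProfile (θ_{j,1}) (θ_{j,2}) pipeBump (pipeCenter j)` — **the profiles `φ̃_j`**: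
  smooth, `[0,1]`-valued, `= 1` at the centre, annihilated by `θ_j · ∇`
  (`sum_mul_partialDeriv_pipeFn_eq_zero`, from `MikadoPipeProfiles`), with all-orders derivative bounds
  `CP25.pipeDerivConst` (`hasLiftDerivBounds_pipeFn`: `HasLiftDerivBounds n (pipeFn j) (pipeDerivConst n) 1`);
* `CP25.pipeFn_mul_pipeFn_eq_zero` — **pairwise disjointness** `φ̃_i φ̃_j ≡ 0` for `i ≠ j`. Proof: if `y`
  lies in both pipes then, with `n = θ_i × θ_j ∈ ℤ³` (Mathlib `crossProduct`; `n·θ_i = n·θ_j = 0`, `|n_l| ≤ 4`), the real number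
  `n·(X_j - X_i)` is within `16 · 5·10⁻⁶ < 10⁻⁴` of an integer (the transverse coordinates of `y` in each
  pipe are within `5·10⁻⁶` of lattice points), whereas `n·(X_j - X_i) = (j-i)·10⁻⁴·(n·(1,10,100))` is a
  NONZERO multiple of `10⁻⁴` of size `≤ 0.222` (`n·(1,10,100) ≠ 0` for these `n`, by `decide`), hence at
  distance `≥ 10⁻⁴` from `ℤ`;
* `CP25.pipeSet = ⋃_j {φ̃_j ≠ 0}` (the set `P` fed to the nested cut-offs `Torus.nestedCutoff`).

## Mathlib / tree search

Tree: `CP25.pipeProfile`, `pipeProfile_proj`, `isSmooth_pipeProfile`, `pipeProfile_apply_center`,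
`sum_mul_partialDeriv_pipeProfile_nash_eq_zero` (`MikadoPipeProfiles`), `CP25.nashDir`, `CP25.dirVec`,
`Torus.exists_plateau_cutoff` (`TorusPlateauCutoff`), `Torus.mulVecT_proj`, `Torus.planarProj_proj`.
Mathlib: `UnitAddCircle.norm_eq`, `dist_pi_lt_iff`, `thickening_singleton`. `lean search 'pipes.*disjoint|pipeCenter'`:
nothing prior (the tree's `MikadoFlows*` files treat one direction at a time).

## References

* M. P. Coiculescu, S. Palasek, Invent. Math. 244 (2025) 165–219, doi:10.1007/s00222-025-01396-z,
  arXiv:2503.14699: §3.1 (directions, shifts, profiles `φ̃_j`, (pipesseparated)), Lemma 3.2, proof of Prop. 4.1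
  (`𝒩_{k,3} = 0`). [CoiculescuPalasek2025]
* S. Daneri, L. Székelyhidi Jr., *Non-uniqueness and h-principle for Hölder-continuous weak solutions of the
  Euler equations*, ARMA 224 (2017), Lemma 2.3 / §4.1 (disjoint periodic pipes in `𝕋³` for finitely many
  rational directions — the Mikado geometry). [DaneriSzekelyhidi2017]
-/

noncomputable section

open Set Metric Function
open scoped BigOperators

namespace Literature.Analysis.FluidPDE

namespace CP25

open Literature.Analysis.FunctionSpaces Literature.Analysis.FunctionSpaces.Torus

/-! ## The arithmetic data: cross products, the generic shift direction, the step -/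

open scoped Matrix

/-- `(a × b) · a = 0` (Mathlib `dot_self_cross`, in the `∑ nₗ aₗ` form used below). [folklore] -/
theorem crossProduct_dot_left (a b : Fin 3 → ℤ) : ∑ l, (a ⨯₃ b) l * a l = 0 := by
  have h := dot_self_cross a b
  rw [dotProduct] at h
  simpa [mul_comm] using h

/-- `(a × b) · b = 0` (Mathlib `dot_cross_self`). [folklore] -/
theorem crossProduct_dot_right (a b : Fin 3 → ℤ) : ∑ l, (a ⨯₃ b) l * b l = 0 := by
  have h := dot_cross_self a b
  rw [dotProduct] at h
  simpa [mul_comm] using h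

/-- The generic shift direction `w = (1, 10, 100)` — a choice realising §3.1 (the paper only asserts that suitable
`x_j` exist). [folklore] -/
def shiftDir : Fin 3 → ℤ := ![1, 10, 100]

/-- The shift step `ε = 10⁻⁴` — a choice realising §3.1. [folklore] -/
def shiftStep : ℝ := 1 / 10000

/-- The pipe radius `δ₁ = 10⁻⁶` (plateau radius of the planar profile; its support has radius `5δ₁`) — a choice
realising the width `δ₀` of §3.1. [folklore] -/
def pipeRadius : ℝ := 1 / 1000000

/-- `n_{ij} · w` with `n_{ij} = θ_i × θ_j` (Mathlib `crossProduct`) for the Nash directions, as an integer. [folklore] -/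
def crossDotShift (i j : Fin 6) : ℤ := ∑ l, (nashDir i ⨯₃ nashDir j) l * shiftDir l

/-- `crossDotShift` written out in the entries of the Nash directions. [folklore] -/
theorem crossDotShift_eq (i j : Fin 6) : crossDotShift i j =
    (nashDir i 1 * nashDir j 2 - nashDir i 2 * nashDir j 1) * 1 + (nashDir i 2 * nashDir j 0 - nashDir i 0 * nashDir j 2) * 10 +
      (nashDir i 0 * nashDir j 1 - nashDir i 1 * nashDir j 0) * 100 := by
  simp [crossDotShift, cross_apply, shiftDir, Fin.sum_univ_three]

/-- **`n_{ij} · w ≠ 0` for `i ≠ j`** (the six Nash directions are pairwise non-parallel and `w` is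
generic for their cross products). [folklore] -/
theorem crossDotShift_ne_zero : ∀ i j : Fin 6, i ≠ j → crossDotShift i j ≠ 0 := by
  intro i j hij
  rw [crossDotShift_eq]
  revert i j
  decide

/-- `|n_{ij} · w| ≤ 444`. [folklore] -/
theorem abs_crossDotShift_le : ∀ i j : Fin 6, |crossDotShift i j| ≤ 444 := by
  intro i j
  rw [crossDotShift_eq]
  revert i j
  decide

/-- The entries of `n_{ij} = θ_i × θ_j` are bounded by `4`. [folklore] -/
theorem abs_crossProduct_nashDir_le : ∀ (i j : Fin 6) (l : Fin 3), |(nashDir i ⨯₃ nashDir j) l| ≤ 4 := by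
  intro i j l
  fin_cases l <;> simp [cross_apply] <;> revert i j <;> decide

/-- `0 < ε`. [folklore] -/
theorem shiftStep_pos : 0 < shiftStep := by norm_num [shiftStep]

/-- `0 < δ₁`. [folklore] -/
theorem pipeRadius_pos : 0 < pipeRadius := by norm_num [pipeRadius]

/-- `δ₁ ≤ 1/4`. [folklore] -/
theorem pipeRadius_le : pipeRadius ≤ 1 / 4 := by norm_num [pipeRadius]

/-- The separation inequality `16 · (5δ₁) < ε`. [folklore] -/
theorem sixteen_mul_support_lt_shiftStep : 16 * (5 * pipeRadius) < shiftStep := by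
  norm_num [pipeRadius, shiftStep]

/-! ## The shifts and the centres -/

/-- The lifted shifts `X_j = (j+1) ε w ∈ ℝ³` — a choice realising §3.1. [folklore] -/
def pipeShiftE (j : Fin 6) : EuclideanSpace ℝ (Fin 3) := (((j : ℕ) + 1 : ℝ) * shiftStep) • dirVec shiftDir

/-- The pipe centres `x_j = proj X_j ∈ 𝕋³` — a choice realising §3.1. [folklore] -/
def pipeCenter (j : Fin 6) : UnitAddTorus (Fin 3) := proj (pipeShiftE j)

/-- Coordinates of the shifts. [folklore] -/
theorem pipeShiftE_apply (j : Fin 6) (l : Fin 3) :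
    pipeShiftE j l = (((j : ℕ) + 1 : ℝ) * shiftStep) * shiftDir l := by
  simp [pipeShiftE, dirVec_apply]

/-- **The key arithmetic fact**: `n_{ij} · (X_j - X_i) = (j - i) ε (n_{ij} · w)`. [folklore] -/
theorem sum_cross_mul_shift_sub (i j : Fin 6) :
    ∑ l, ((nashDir i ⨯₃ nashDir j) l : ℝ) * (pipeShiftE j l - pipeShiftE i l) =
      (((j : ℕ) : ℝ) - ((i : ℕ) : ℝ)) * shiftStep * (crossDotShift i j : ℝ) := by
  simp only [pipeShiftE_apply, crossDotShift]
  push_cast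
  simp only [Finset.mul_sum]
  refine Finset.sum_congr rfl fun l _ => ?_
  ring

/-- **`n_{ij} · (X_j - X_i)` is at distance `≥ ε` from every integer** (`i ≠ j`). [folklore] -/
theorem shiftStep_le_abs_sub_int {i j : Fin 6} (hij : i ≠ j) (z : ℤ) :
    shiftStep ≤ |∑ l, ((nashDir i ⨯₃ nashDir j) l : ℝ) * (pipeShiftE j l - pipeShiftE i l) - z| := by
  rw [sum_cross_mul_shift_sub]
  set q : ℤ := ((j : ℕ) : ℤ) - ((i : ℕ) : ℤ) with hq
  have hqne : q ≠ 0 := by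
    intro h0
    apply hij
    have : ((j : ℕ) : ℤ) = ((i : ℕ) : ℤ) := by omega
    exact Fin.ext (by exact_mod_cast this.symm)
  have hqle : |q| ≤ 5 := by
    have hi := i.isLt; have hj := j.isLt
    rw [abs_le]; constructor <;> omega
  have hc := crossDotShift_ne_zero i j hij
  have hcle := abs_crossDotShift_le i j
  -- the value is `ε · (q c)` with `q c` a nonzero integer of size `≤ 2220`
  have hval : (((j : ℕ) : ℝ) - ((i : ℕ) : ℝ)) * shiftStep * (crossDotShift i j : ℝ) =
      shiftStep * ((q * crossDotShift i j : ℤ) : ℝ) := by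
    push_cast; rw [hq]; push_cast; ring
  rw [hval]
  set m : ℤ := q * crossDotShift i j with hm
  have hmne : m ≠ 0 := mul_ne_zero hqne hc
  have hmle : |m| ≤ 2220 := by
    rw [hm, abs_mul]
    calc |q| * |crossDotShift i j| ≤ 5 * 444 := mul_le_mul hqle hcle (abs_nonneg _) (by norm_num)
      _ = 2220 := by norm_num
  have hm1 : (1 : ℝ) ≤ |(m : ℝ)| := by
    rw [← Int.cast_abs]; exact_mod_cast Int.one_le_abs hmne
  have hm2 : |(m : ℝ)| ≤ 2220 := by
    rw [← Int.cast_abs]; exact_mod_cast hmle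
  have hε : shiftStep = 1 / 10000 := rfl
  rcases eq_or_ne z 0 with rfl | hz
  · rw [Int.cast_zero, sub_zero, abs_mul, abs_of_pos shiftStep_pos]
    nlinarith [shiftStep_pos]
  · have hz1 : (1 : ℝ) ≤ |(z : ℝ)| := by
      rw [← Int.cast_abs]; exact_mod_cast Int.one_le_abs hz
    -- `|ε m - z| ≥ |z| - ε|m| ≥ 1 - 0.222`
    have h1 : |(z : ℝ)| - |shiftStep * (m : ℝ)| ≤ |shiftStep * (m : ℝ) - z| := by
      have := abs_sub_abs_le_abs_sub (z : ℝ) (shiftStep * m)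
      rwa [abs_sub_comm] at this
    have h2 : |shiftStep * (m : ℝ)| ≤ 2220 / 10000 := by
      rw [abs_mul, abs_of_pos shiftStep_pos, hε]; nlinarith
    rw [hε] at h1 h2 ⊢
    linarith

/-! ## The planar bump and the profiles -/

/-- **The planar profile**: a smooth `ρ : 𝕋² → [0,1]` with `ρ = 1` on the ball of radius `δ₁` about `0`
and `ρ = 0` off the ball of radius `5δ₁` (the radial profile `φ` of §3.1, "chosen even with `φ(0) = 1`",
here realised by a plateau cut-off). [cite: CoiculescuPalasek2025, §3.1] -/
def pipeBump : UnitAddTorus (Fin 2) → ℝ :=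
  Classical.choose (exists_plateau_cutoff ({0} : Set (UnitAddTorus (Fin 2))) pipeRadius_pos pipeRadius_le)

/-- The defining properties of `pipeBump`. [cite: CoiculescuPalasek2025, §3.1] -/
theorem pipeBump_spec :
    IsSmooth pipeBump ∧ (∀ z, 0 ≤ pipeBump z ∧ pipeBump z ≤ 1) ∧
      (∀ z ∈ thickening pipeRadius ({0} : Set (UnitAddTorus (Fin 2))), pipeBump z = 1) ∧
      (∀ z ∉ thickening (5 * pipeRadius) ({0} : Set (UnitAddTorus (Fin 2))), pipeBump z = 0) ∧
      ∀ (n : ℕ) (y : EuclideanSpace ℝ (Fin 2)),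
        ‖iteratedFDeriv ℝ n (lift pipeBump) y‖ ≤ derivProfileMass (Fin 2) n * (pipeRadius ^ n)⁻¹ :=
  Classical.choose_spec (exists_plateau_cutoff ({0} : Set (UnitAddTorus (Fin 2))) pipeRadius_pos pipeRadius_le)

/-- `ρ` is smooth. [folklore] -/
theorem isSmooth_pipeBump : IsSmooth pipeBump := pipeBump_spec.1

/-- `0 ≤ ρ ≤ 1`. [folklore] -/
theorem pipeBump_mem_Icc (z : UnitAddTorus (Fin 2)) : 0 ≤ pipeBump z ∧ pipeBump z ≤ 1 := pipeBump_spec.2.1 z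

/-- `ρ = 1` on the ball of radius `δ₁`. [folklore] -/
theorem pipeBump_eq_one {z : UnitAddTorus (Fin 2)} (hz : dist z 0 < pipeRadius) : pipeBump z = 1 :=
  pipeBump_spec.2.2.1 z (by rw [thickening_singleton]; exact mem_ball.2 hz)

/-- `ρ 0 = 1`. [folklore] -/
theorem pipeBump_zero : pipeBump 0 = 1 := pipeBump_eq_one (by rw [dist_self]; exact pipeRadius_pos)

/-- `ρ z ≠ 0` forces `dist z 0 < 5δ₁`. [folklore] -/
theorem dist_lt_of_pipeBump_ne_zero {z : UnitAddTorus (Fin 2)} (hz : pipeBump z ≠ 0) : dist z 0 < 5 * pipeRadius := by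
  by_contra h
  exact hz (pipeBump_spec.2.2.2.1 z (by rw [thickening_singleton, mem_ball]; exact h))

/-- **The profiles `φ̃_j`** of Coiculescu–Palasek: the planar bump pulled back along the `j`-th Nash
direction around the centre `x_j`. [cite: CoiculescuPalasek2025, §3.1] -/
def pipeFn (j : Fin 6) : UnitAddTorus (Fin 3) → ℝ :=
  pipeProfile (nashDir j 0) (nashDir j 1) pipeBump (pipeCenter j)

/-- **The pipe set `P = ⋃_j {φ̃_j ≠ 0}`** (fed to `Torus.nestedCutoff`). [cite: CoiculescuPalasek2025, Def. 3.1 (`Ω_{j,k}`)] -/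
def pipeSet : Set (UnitAddTorus (Fin 3)) := ⋃ j, {y | pipeFn j y ≠ 0}

/-- `φ̃_j` is smooth. [folklore] -/
theorem isSmooth_pipeFn (j : Fin 6) : IsSmooth (pipeFn j) :=
  isSmooth_pipeProfile _ _ isSmooth_pipeBump _

/-- `0 ≤ φ̃_j ≤ 1`. [cite: CoiculescuPalasek2025, §3.1] -/
theorem pipeFn_mem_Icc (j : Fin 6) (y : UnitAddTorus (Fin 3)) : 0 ≤ pipeFn j y ∧ pipeFn j y ≤ 1 :=
  pipeProfile_mem (S := Icc (0 : ℝ) 1) (fun z => pipeBump_mem_Icc z) _ y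

/-- `|φ̃_j| ≤ 1`. [folklore] -/
theorem abs_pipeFn_le_one (j : Fin 6) (y : UnitAddTorus (Fin 3)) : |pipeFn j y| ≤ 1 := by
  have h := pipeFn_mem_Icc j y
  rw [abs_of_nonneg h.1]; exact h.2

/-- `φ̃_j(x_j) = 1`. [cite: CoiculescuPalasek2025, §3.1 ("`φ(0) = 1`")] -/
theorem pipeFn_center (j : Fin 6) : pipeFn j (pipeCenter j) = 1 := by
  rw [pipeFn, pipeProfile_apply_center, pipeBump_zero]

/-- The support of `φ̃_j` lies in `P`. [folklore] -/
theorem mem_pipeSet_of_ne_zero {j : Fin 6} {y : UnitAddTorus (Fin 3)} (hy : pipeFn j y ≠ 0) : y ∈ pipeSet :=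
  mem_iUnion.2 ⟨j, hy⟩

/-- **`θ_j · ∇φ̃_j = 0`** (the profile is constant along its pipe). [cite: CoiculescuPalasek2025, §3.1] -/
theorem sum_mul_partialDeriv_pipeFn_eq_zero (j : Fin 6) (y : UnitAddTorus (Fin 3)) :
    ∑ i, (nashDir j i : ℝ) * Torus.partialDeriv i (pipeFn j) y = 0 :=
  sum_mul_partialDeriv_pipeProfile_nash_eq_zero j (isSmooth_pipeBump.isContDiff (by simp)) (pipeCenter j) y

/-! ## Transverse coordinates: a point of the pipe is close to a lattice translate of the axis -/

/-- The real matrix of `pipeMatrix θ₁ θ₂` acting on `Y`: `(Y₀ - θ₁Y₂, Y₁ - θ₂Y₂, Y₂)`. [folklore] -/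
theorem pipeMatrix_map_mulVec (θ₁ θ₂ : ℤ) (Y : Fin 3 → ℝ) :
    ((pipeMatrix θ₁ θ₂).map (Int.cast : ℤ → ℝ)).mulVec Y = ![Y 0 - θ₁ * Y 2, Y 1 - θ₂ * Y 2, Y 2] := by
  ext l
  fin_cases l <;> simp [pipeMatrix, Matrix.mulVec, dotProduct, Fin.sum_univ_three] <;> ring

/-- **Transverse coordinates of a point in the support of `φ̃_j`**: if `φ̃_j(proj Y) ≠ 0` then the two
transverse coordinates `(Y - X_j)_l - θ_{j,l} (Y - X_j)_2` (`l = 0, 1`) are within `5δ₁` of integers.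
[cite: CoiculescuPalasek2025, §3.1] -/
theorem exists_int_near_of_pipeFn_ne_zero {j : Fin 6} {Y : EuclideanSpace ℝ (Fin 3)}
    (hy : pipeFn j (proj Y) ≠ 0) :
    ∃ m : Fin 2 → ℤ, ∀ l : Fin 2,
      |((Y - pipeShiftE j) (Fin.castSucc l) - (nashDir j (Fin.castSucc l) : ℝ) * (Y - pipeShiftE j) 2) - m l| <
        5 * pipeRadius := by
  -- the argument of `ρ`
  set w : EuclideanSpace ℝ (Fin 2) := planarProjE
    (Matrix.toEuclideanCLM (n := Fin 3) (𝕜 := ℝ) ((pipeMatrix (nashDir j 0) (nashDir j 1)).map (Int.cast : ℤ → ℝ))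
      (Y - pipeShiftE j)) with hw
  have hval : pipeFn j (proj Y) = pipeBump (proj w) := by
    rw [pipeFn, pipeCenter, pipeProfile_proj]
  rw [hval] at hy
  have hdist := dist_lt_of_pipeBump_ne_zero hy
  have hr : 0 < 5 * pipeRadius := by have := pipeRadius_pos; positivity
  rw [dist_pi_lt_iff hr] at hdist
  refine ⟨fun l => round (w l), fun l => ?_⟩
  have hl := hdist l
  rw [Pi.zero_apply, dist_zero_right, proj_apply, UnitAddCircle.norm_eq] at hl
  -- identify the coordinate of `w`
  have hwl : w l = (Y - pipeShiftE j) (Fin.castSucc l) - (nashDir j (Fin.castSucc l) : ℝ) * (Y - pipeShiftE j) 2 := by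
    rw [hw, planarProjE_apply]
    change (WithLp.toLp 2 (((pipeMatrix (nashDir j 0) (nashDir j 1)).map (Int.cast : ℤ → ℝ)).mulVec
      (WithLp.ofLp (Y - pipeShiftE j)))) (Fin.castSucc l) = _
    rw [pipeMatrix_map_mulVec]
    fin_cases l <;> simp
  rw [← hwl]; exact hl

/-! ## Pairwise disjointness of the six pipes -/

/-- `n_{ij} · θ_i = 0` written out with `θ_{i,2} = 1`, over `ℝ`. [folklore] -/
theorem cross_orth_nashDir_left (i j : Fin 6) :
    ((nashDir i ⨯₃ nashDir j) 0 : ℝ) * nashDir i 0 + (nashDir i ⨯₃ nashDir j) 1 * nashDir i 1 +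
      (nashDir i ⨯₃ nashDir j) 2 = 0 := by
  have h := crossProduct_dot_left (nashDir i) (nashDir j)
  rw [Fin.sum_univ_three, nashDir_apply_two, mul_one] at h
  exact_mod_cast h

/-- `n_{ij} · θ_j = 0` written out with `θ_{j,2} = 1`, over `ℝ`. [folklore] -/
theorem cross_orth_nashDir_right (i j : Fin 6) :
    ((nashDir i ⨯₃ nashDir j) 0 : ℝ) * nashDir j 0 + (nashDir i ⨯₃ nashDir j) 1 * nashDir j 1 +
      (nashDir i ⨯₃ nashDir j) 2 = 0 := by
  have h := crossProduct_dot_right (nashDir i) (nashDir j)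
  rw [Fin.sum_univ_three, nashDir_apply_two, mul_one] at h
  exact_mod_cast h

/-- `|n_l x| ≤ 4|x|` for the entries of `n_{ij}`. [folklore] -/
theorem abs_cross_mul_le (i j : Fin 6) (l : Fin 3) (x : ℝ) :
    |((nashDir i ⨯₃ nashDir j) l : ℝ) * x| ≤ 4 * |x| := by
  rw [abs_mul]
  refine mul_le_mul_of_nonneg_right ?_ (abs_nonneg _)
  have h := abs_crossProduct_nashDir_le i j l
  rw [← Int.cast_abs]; exact_mod_cast h

/-- **The six pipes are pairwise disjoint**: `φ̃_i(y) φ̃_j(y) = 0` for `i ≠ j` and every `y ∈ 𝕋³`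
(assumption (pipesseparated) of §3.1, realised by the explicit shifts `x_j = (j+1)·10⁻⁴·(1,10,100)` and the
width `5·10⁻⁶`). [cite: CoiculescuPalasek2025, §3.1 (pipesseparated) and Lemma 3.2] -/
theorem pipeFn_mul_pipeFn_eq_zero {i j : Fin 6} (hij : i ≠ j) (y : UnitAddTorus (Fin 3)) :
    pipeFn i y * pipeFn j y = 0 := by
  by_contra hne
  have hi : pipeFn i y ≠ 0 := left_ne_zero_of_mul hne
  have hj : pipeFn j y ≠ 0 := right_ne_zero_of_mul hne
  obtain ⟨Y, rfl⟩ := proj_surjective y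
  obtain ⟨mi, hmi⟩ := exists_int_near_of_pipeFn_ne_zero hi
  obtain ⟨mj, hmj⟩ := exists_int_near_of_pipeFn_ne_zero hj
  have hi0 := hmi 0
  have hi1 := hmi 1
  have hj0 := hmj 0
  have hj1 := hmj 1
  simp only [Fin.castSucc_zero, Fin.castSucc_one] at hi0 hi1 hj0 hj1
  set n := nashDir i ⨯₃ nashDir j with hn
  set u : EuclideanSpace ℝ (Fin 3) := Y - pipeShiftE i with hu
  set v : EuclideanSpace ℝ (Fin 3) := Y - pipeShiftE j with hv
  -- the integer near `n · (X_j - X_i)`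
  set Z : ℤ := n 0 * (mi 0 - mj 0) + n 1 * (mi 1 - mj 1) with hZ
  have hsep := shiftStep_le_abs_sub_int hij Z
  -- `n · (X_j - X_i) = n · (u - v)`
  have hdiff : ∀ l, pipeShiftE j l - pipeShiftE i l = u l - v l := by
    intro l; simp only [hu, hv, PiLp.sub_apply]; ring
  simp only [hdiff, Fin.sum_univ_three] at hsep
  have ho_i := cross_orth_nashDir_left i j
  have ho_j := cross_orth_nashDir_right i j
  rw [← hn] at ho_i ho_j
  -- the algebraic identity isolating the transverse errors
  have hid : (n 0 : ℝ) * (u 0 - v 0) + (n 1 : ℝ) * (u 1 - v 1) + (n 2 : ℝ) * (u 2 - v 2) - (Z : ℝ) =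
      (n 0 : ℝ) * ((u 0 - (nashDir i 0 : ℝ) * u 2 - mi 0) - (v 0 - (nashDir j 0 : ℝ) * v 2 - mj 0)) +
      (n 1 : ℝ) * ((u 1 - (nashDir i 1 : ℝ) * u 2 - mi 1) - (v 1 - (nashDir j 1 : ℝ) * v 2 - mj 1)) +
      u 2 * ((n 0 : ℝ) * nashDir i 0 + n 1 * nashDir i 1 + n 2) -
      v 2 * ((n 0 : ℝ) * nashDir j 0 + n 1 * nashDir j 1 + n 2) := by
    rw [hZ]; push_cast; ring
  rw [ho_i, ho_j, mul_zero, mul_zero, sub_zero, add_zero] at hid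
  rw [hid] at hsep
  -- bound the transverse errors
  have hb0 := abs_cross_mul_le i j 0 ((u 0 - (nashDir i 0 : ℝ) * u 2 - mi 0) - (v 0 - (nashDir j 0 : ℝ) * v 2 - mj 0))
  have hb1 := abs_cross_mul_le i j 1 ((u 1 - (nashDir i 1 : ℝ) * u 2 - mi 1) - (v 1 - (nashDir j 1 : ℝ) * v 2 - mj 1))
  rw [← hn] at hb0 hb1
  have ht0 := abs_sub (u 0 - (nashDir i 0 : ℝ) * u 2 - mi 0) (v 0 - (nashDir j 0 : ℝ) * v 2 - mj 0)
  have ht1 := abs_sub (u 1 - (nashDir i 1 : ℝ) * u 2 - mi 1) (v 1 - (nashDir j 1 : ℝ) * v 2 - mj 1)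
  have hadd := abs_add_le
    ((n 0 : ℝ) * ((u 0 - (nashDir i 0 : ℝ) * u 2 - mi 0) - (v 0 - (nashDir j 0 : ℝ) * v 2 - mj 0)))
    ((n 1 : ℝ) * ((u 1 - (nashDir i 1 : ℝ) * u 2 - mi 1) - (v 1 - (nashDir j 1 : ℝ) * v 2 - mj 1)))
  have hlt := sixteen_mul_support_lt_shiftStep
  linarith

/-! ## All-orders derivative bounds of the profiles -/

/-- A uniform bound of the `n`-th derivatives of the lifted profile `φ̃_j` (continuous, periodic, hence
bounded: the supremum over the compact fundamental cube, made level-independent by `max` over `j`).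
[cite: CoiculescuPalasek2025, §2.4 (implicit constants depend on the profile)] -/
theorem exists_forall_norm_iteratedFDeriv_lift_pipeFn_le (n : ℕ) :
    ∃ C : ℝ, 0 ≤ C ∧ ∀ (j : Fin 6) (y : EuclideanSpace ℝ (Fin 3)), ‖iteratedFDeriv ℝ n (lift (pipeFn j)) y‖ ≤ C := by
  have hj : ∀ j : Fin 6, ∃ C : ℝ, ∀ y : EuclideanSpace ℝ (Fin 3), ‖iteratedFDeriv ℝ n (lift (pipeFn j)) y‖ ≤ C :=
    fun j => eSupNorm_lt_top_iff.1 ((isSmooth_pipeFn j).eSupNorm_iteratedFDeriv_lift_lt_top n)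
  choose C hC using hj
  refine ⟨max 0 (Finset.univ.sup' Finset.univ_nonempty C), le_max_left _ _, fun j y => ?_⟩
  exact (hC j y).trans ((Finset.le_sup' C (Finset.mem_univ j)).trans (le_max_right _ _))

/-- **The profile derivative constants `G_n`** (a choice), monotone-free packaging as
`HasLiftDerivBounds n (φ̃_j) (pipeDerivConst n) 1` for all `j`. [cite: CoiculescuPalasek2025, §2.4] -/
def pipeDerivConst (n : ℕ) : ℝ :=
  (Finset.range (n + 1)).sum fun i => Classical.choose (exists_forall_norm_iteratedFDeriv_lift_pipeFn_le i)

/-- `0 ≤ G_n`. [folklore] -/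
theorem pipeDerivConst_nonneg (n : ℕ) : 0 ≤ pipeDerivConst n :=
  Finset.sum_nonneg fun i _ => (Classical.choose_spec (exists_forall_norm_iteratedFDeriv_lift_pipeFn_le i)).1

/-- **`HasLiftDerivBounds n φ̃_j (G_n) 1`** — the hypothesis `Admissible.profile` of the data iteration.
[cite: CoiculescuPalasek2025, §2.4 and Lemma 3.6] -/
theorem hasLiftDerivBounds_pipeFn (n : ℕ) (j : Fin 6) : HasLiftDerivBounds n (pipeFn j) (pipeDerivConst n) 1 := by
  refine hasLiftDerivBounds_of_forall_le_one (isSmooth_pipeFn j)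
    (G := fun i => Classical.choose (exists_forall_norm_iteratedFDeriv_lift_pipeFn_le i))
    (fun i _ y => (Classical.choose_spec (exists_forall_norm_iteratedFDeriv_lift_pipeFn_le i)).2 j y)
    fun i hi => ?_
  unfold pipeDerivConst
  refine Finset.single_le_sum (f := fun i => Classical.choose (exists_forall_norm_iteratedFDeriv_lift_pipeFn_le i))
    (fun k _ => (Classical.choose_spec (exists_forall_norm_iteratedFDeriv_lift_pipeFn_le k)).1)
    (Finset.mem_range.2 (Nat.lt_succ_of_le hi))

end CP25

end Literature.Analysis.FluidPDE
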